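import Mathlib.Analysis.Calculus.Gradient.Basic
import Mathlib.Analysis.InnerProductSpace.Calculus
import Mathlib.Analysis.SpecialFunctions.Sqrt
import Mathlib.Analysis.SpecialFunctions.Pow.Deriv
import Literature.Geometry.Lorentzian.SpacelikeGraphMinkowski
import Literature.Geometry.Lorentzian.ModelSpaceNormalDerivative
import Literature.Geometry.Lorentzian.InducedVacuumData
import Literature.Geometry.Lorentzian.MinkowskiCauchyDevelopment
import Literature.Geometry.Lorentzian.SpacetimePositiveMassRigidityProofs
import Literature.Topology.FourManifolds.SmoothEmbeddingComp
import HarnessLib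

/-!
# Uniformly spacelike entire graphs in Minkowski space-time are vacuum Cauchy developments

The rigid positive energy theorem (Beig–Chruściel, J. Math. Phys. 37 (1996), Thm. 4.1 with
`m = 0`; vendored as the named fact `positive_mass_rigidity_spacetime`,
`SpacetimePositiveMassRigidity.lean`) concludes that zero-energy data `(Σ, h, K)` embed
isometrically, with `K` the second fundamental form, onto a hypersurface of Minkowski space-time
which "is necessarily a graph over a spacelike plane `t = 0`" (proof of Thm. 4.1, §4, last
paragraph) — so that Minkowski space-time is a Cauchy development of the data. This file
constructs, sorry-free and without any new definition or named fact, the whole family of objects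
that conclusion speaks about: for every `u : ℝ³ → ℝ` of class `C^∞` with `‖du‖ ≤ θ < 1`,

* `Minkowski.isSpacelikeImmersion_graph_slice`, `Minkowski.isSmoothEmbedding_graph_slice` — the
  graph map `y ↦ (u(y), y)` is a smooth spacelike embedding of the Minkowski slice
  `Minkowski.slice = ℝ³` into `(ℝ⁴, η)` (O'Neill 1983, Ch. 4, p. 97 and Ch. 5, p. 142;
  Hawking–Ellis 1973, §2.3);
* `Minkowski.isFutureUnitNormal_graph_slice`, `Minkowski.contMDiff_lift_graph_slice` — the field
  `ν = (1 − ‖∇u‖²)^{-1/2} (1, ∇u)` is its smooth future unit normal (Wald 1984, §10.2);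
* `Minkowski.bilin_fderiv_normalMap_tangent` — `η(dν v, d(graph u) w) = (1 − ‖∇u‖²)^{-1/2}
  ⟪d(∇u) v, w⟫` (the second fundamental form of the graph, Wald 1984, (10.2.13));
* `Minkowski.exists_vacuumCauchyDevelopment_graph` — **main result**: there is an initial data
  set `D = (δ − du ⊗ du, (1 − ‖∇u‖²)^{-1/2} ∇∇u)` on `slice` (the data induced by `η`,
  `PseudoRiemannianMetric.exists_initialDataSet_induced_isVacuumConstraintSolution`), solving the
  vacuum constraints (Choquet-Bruhat 2009, Ch. VI, Thm. 3.3), with a `VacuumCauchyDevelopment`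
  whose space-time is `Minkowski.spacetime` (the image is a Cauchy hypersurface by
  `Minkowski.isCauchyHypersurface_range_graph_of_fderiv`, `SpacetimePositiveMassRigidityProofs`);
* `Minkowski.exists_cauchyDevelopment_eq_spacetime_graph` — hence the literal conclusion
  `∃ 𝒟 : CauchyDevelopment D, 𝒟.toSpacetime = Minkowski.spacetime` of
  `positive_mass_rigidity_spacetime` holds for every member of the family (the member `u = 0` is
  `Minkowski.vacuumCauchyDevelopment`, `MinkowskiCauchyDevelopment.lean`, and
  `positive_mass_rigidity_spacetime_conclusion_trivialData`).

The computations in the flat ambient space use `ModelSpace.secondFundamentalForm_eq_mfderiv`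
(`ModelSpaceNormalDerivative.lean`) and the Minkowski-form identities of
`SpacelikeGraphMinkowski.lean`. Theorems only (D-0026).

## References

* R. Beig, P. T. Chruściel, *Killing vectors in asymptotically flat space-times. I*, J. Math.
  Phys. 37 (1996) 1939–1961, Thm. 4.1 and its proof, §4. [BeigChrusciel1996]
* R. M. Wald, *General Relativity*, Chicago 1984, §10.2, (10.2.10)–(10.2.13). [Wald1984]
* B. O'Neill, *Semi-Riemannian geometry*, Academic Press 1983, Ch. 4, p. 97, Lemma 4.4; Ch. 5,
  p. 142. [ONeill1983]
* Y. Choquet-Bruhat, *General Relativity and the Einstein Equations*, OUP 2009, Ch. VI,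
  Thm. 3.3. [ChoquetBruhat2009]
* S. W. Hawking, G. F. R. Ellis, *The large scale structure of space-time*, CUP 1973, §2.3,
  §6.5. [HawkingEllis1973]
-/

noncomputable section

open Bundle Set Function Topology InnerProductSpace Manifold
open scoped Manifold ContDiff RealInnerProductSpace Gradient NNReal

namespace Literature.Geometry.Lorentzian

namespace Minkowski

variable {u : E3 → ℝ}

/-! ### The gradient and the normal map of a smooth function -/

/-- `‖∇u(y)‖ = ‖du_y‖` (the Riesz isometry; private copy of the FluidPDE helper of the same
name, which is outside this file's import cone). [folklore] -/
private theorem norm_gradient_eq_norm_fderiv (u : E3 → ℝ) (y : E3) :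
    ‖∇ u y‖ = ‖fderiv ℝ u y‖ := by
  rw [gradient, LinearIsometryEquiv.norm_map]

/-- The gradient of a `C^∞` function is `C^∞` (`du` is, and the Riesz isometry is linear;
private copy of `contDiff_gradient_of_contDiff_top`, `FluidPDE`, outside the import cone).
[folklore] -/
private theorem contDiff_gradient (hu : ContDiff ℝ ∞ u) : ContDiff ℝ ∞ fun y ↦ ∇ u y := by
  have h1 : ContDiff ℝ ∞ (fderiv ℝ u) := hu.fderiv_right (m := ∞) (by rfl)
  exact (InnerProductSpace.toDual ℝ E3).symm.contDiff.comp h1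

/-- The normalising factor `(1 − ‖∇u‖²)^{-1/2}` of the unit normal of a graph with `‖∇u‖ < 1`
is `C^∞`. Wald 1984, §10.2 (the unit normal `n^a = −N ∇^a t`). [cite: Wald1984, §10.2] -/
theorem contDiff_normalFactor (hu : ContDiff ℝ ∞ u) (hlt : ∀ y, ‖∇ u y‖ < 1) :
    ContDiff ℝ ∞ fun y ↦ (Real.sqrt (1 - ‖∇ u y‖ ^ 2))⁻¹ := by
  have hpos : ∀ y, 0 < 1 - ‖∇ u y‖ ^ 2 := fun y ↦ by nlinarith [hlt y, norm_nonneg (∇ u y)]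
  refine ContDiff.inv ?_ fun y ↦ (Real.sqrt_pos.mpr (hpos y)).ne'
  exact (contDiff_const.sub ((contDiff_gradient hu).norm_sq ℝ)).sqrt fun y ↦ (hpos y).ne'

/-- The unit normal map `y ↦ (1 − ‖∇u(y)‖²)^{-1/2} (1, ∇u(y)) ∈ ℝ⁴` of a `C^∞` graph with
`‖∇u‖ < 1` is `C^∞`. Wald 1984, §10.2. [cite: Wald1984, §10.2] -/
theorem contDiff_normalMap (hu : ContDiff ℝ ∞ u) (hlt : ∀ y, ‖∇ u y‖ < 1) :
    ContDiff ℝ ∞ fun y ↦ (Real.sqrt (1 - ‖∇ u y‖ ^ 2))⁻¹ • E4.ofTimeSpace 1 (∇ u y) := by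
  have h2 : ContDiff ℝ ∞ fun y ↦ E4.ofTimeSpace 1 (∇ u y) := by
    have : (fun y ↦ E4.ofTimeSpace 1 (∇ u y)) =
        fun y ↦ (1 : ℝ) • E4.basisVector 0 + E4.ofTimeSpace 0 (∇ u y) :=
      funext fun y ↦ E4.ofTimeSpace_eq_smul_add 1 (∇ u y)
    rw [this]
    set L : E3 →L[ℝ] E4 :=
      LinearMap.toContinuousLinearMap (IsLinearMap.mk' _ isLinearMap_ofTimeSpace_zero) with hL
    have hcoe : (L : E3 → E4) = E4.ofTimeSpace 0 := rfl
    rw [← hcoe]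
    exact contDiff_const.add (L.contDiff.comp (contDiff_gradient hu))
  exact (contDiff_normalFactor hu hlt).smul h2

/-! ### The graph over the Minkowski slice: differential, spacelike immersion, unit normal -/

/-- **The differential of the graph map over the Minkowski slice**: for `u` differentiable,
`d(y ↦ (u(y), y))_y v = (⟪∇u(y), v⟫, v)` (the slice `Minkowski.slice = ⊤ ⊆ ℝ³` is an open
submanifold, `OpensChart.mfderiv_eq`, and `fderiv_graph_apply_eq_gradient`). [folklore] -/
theorem mfderiv_graph_slice (hu : Differentiable ℝ u) (y : slice) (v : E3) :
    mfderiv 𝓘(ℝ, E3) 𝓘(ℝ, E4) (fun y : slice ↦ E4.ofTimeSpace (u y) y) y v =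
      E4.ofTimeSpace ⟪∇ u y, v⟫ v := by
  rw [OpensChart.mfderiv_eq y (fun y : slice ↦ E4.ofTimeSpace (u y) y)
    (fun y : E3 ↦ E4.ofTimeSpace (u y) y) (fun _ ↦ rfl) (hasFDerivAt_graph (hu y)).differentiableAt]
  exact fderiv_graph_apply_eq_gradient (hu y) v

/-- The graph map over the slice is `C^m` when `u` is (`contDiff_graph` composed with the
inclusion of the open submanifold). [folklore] -/
theorem contMDiff_graph_slice {m : ℕ∞ω} (hu : ContDiff ℝ m u) :
    ContMDiff 𝓘(ℝ, E3) 𝓘(ℝ, E4) m (fun y : slice ↦ E4.ofTimeSpace (u y) y) :=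
  (contDiff_graph hu).comp_contMDiff contMDiff_subtype_val

/-- **A graph with `‖∇u‖ < 1` is a spacelike immersion of the slice into Minkowski space-time**
(`IsSpacelikeImmersion`: `C^∞` with positive definite induced form; the induced form dominates
`(1 − ‖∇u(y)‖²) δ`, `bilin_tangent_self_ge`). O'Neill 1983, Ch. 5, p. 142 (spacelike
submanifolds); Wald 1984, §10.2. [cite: ONeill1983, Ch. 5, p. 142] -/
theorem isSpacelikeImmersion_graph_slice (hu : ContDiff ℝ ∞ u) (hlt : ∀ y, ‖∇ u y‖ < 1) :
    smoothMetric.toPseudoRiemannianMetric.IsSpacelikeImmersion 𝓘(ℝ, E3)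
      (fun y : slice ↦ E4.ofTimeSpace (u y) y) := by
  refine ⟨?_, fun y (v : E3) hv ↦ ?_⟩
  · have h : ((∞ : ℕ∞ω) + 1) = ∞ := rfl
    rw [h]
    exact contMDiff_graph_slice hu
  · rw [PseudoRiemannianMetric.inducedBilin_apply,
      mfderiv_graph_slice (hu.differentiable (by simp)) y]
    change 0 < bilin (E4.ofTimeSpace ⟪∇ u y, v⟫ v) (E4.ofTimeSpace ⟪∇ u y, v⟫ v)
    have h1 : 0 < 1 - ‖∇ u y‖ ^ 2 := by nlinarith [hlt y, norm_nonneg (∇ u (y : E3))]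
    have h2 : 0 < ‖v‖ := norm_pos_iff.mpr hv
    exact lt_of_lt_of_le (mul_pos h1 (pow_pos h2 2)) (bilin_tangent_self_ge (∇ u y) v)

/-- **The unit normal of a spacelike graph is the future unit normal** of the graph map over
the slice in `(ℝ⁴, η, ∂ₜ)`: `ν(y) = (1 − ‖∇u(y)‖²)^{-1/2} (1, ∇u(y))` is `η`-orthogonal to
`d(graph u)_y v = (⟪∇u, v⟫, v)`, has `η(ν, ν) = −1` and `η(∂ₜ, ν) < 0`
(`bilin_unitNormal_tangent`, `bilin_unitNormal_self`, `bilin_basisVector_zero_unitNormal`).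
Wald 1984, §10.2 (the future unit normal `n^a`); O'Neill 1983, Ch. 5, p. 145.
[cite: Wald1984, §10.2] -/
theorem isFutureUnitNormal_graph_slice (hu : Differentiable ℝ u) (hlt : ∀ y, ‖∇ u y‖ < 1) :
    smoothMetric.IsFutureUnitNormal 𝓘(ℝ, E3) (timeOrientation.ofLE le_top)
      (fun y : slice ↦ E4.ofTimeSpace (u y) y)
      (fun y : slice ↦ (Real.sqrt (1 - ‖∇ u y‖ ^ 2))⁻¹ • E4.ofTimeSpace 1 (∇ u (y : E3))) := by
  refine ⟨⟨fun y v ↦ ?_, fun y ↦ ?_⟩, fun y ↦ ⟨⟨?_, ?_⟩, ?_⟩⟩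
  · -- normal
    rw [mfderiv_graph_slice hu y]
    exact bilin_unitNormal_tangent (∇ u y) v
  · exact bilin_unitNormal_self (hlt y)
  · change bilin _ _ ≤ 0
    rw [bilin_unitNormal_self (hlt y)]
    norm_num
  · intro h0
    have h := bilin_unitNormal_self (hlt y)
    rw [show ((Real.sqrt (1 - ‖∇ u y‖ ^ 2))⁻¹ • E4.ofTimeSpace 1 (∇ u (y : E3)) : E4) = 0 from h0,
      map_zero] at h
    norm_num at h
  · exact bilin_basisVector_zero_unitNormal (hlt y)

/-- The normal map `y ↦ ν(y)` of the graph over the slice is `C^∞` as a map `slice → ℝ⁴`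
(`contDiff_normalMap` composed with the inclusion). [folklore] -/
theorem contMDiff_normal_graph_slice (hu : ContDiff ℝ ∞ u) (hlt : ∀ y, ‖∇ u y‖ < 1) :
    ContMDiff 𝓘(ℝ, E3) 𝓘(ℝ, E4) ∞
      (fun y : slice ↦ (Real.sqrt (1 - ‖∇ u y‖ ^ 2))⁻¹ • E4.ofTimeSpace 1 (∇ u (y : E3))) :=
  (contDiff_normalMap hu hlt).comp_contMDiff contMDiff_subtype_val

/-- **The lift `y ↦ (graph u (y), ν(y)) ∈ Tℝ⁴` is `C^∞`** (trivial tangent bundle of the model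
space: `contMDiffAt_totalSpace`, `trivializationAt_model_space_apply`) — the regularity hypothesis
of `exists_initialDataSet_induced` and of the constraint identities. [folklore] -/
theorem contMDiff_lift_graph_slice (hu : ContDiff ℝ ∞ u) (hlt : ∀ y, ‖∇ u y‖ < 1) :
    ContMDiff 𝓘(ℝ, E3) 𝓘(ℝ, E4).tangent ∞
      (fun y : slice ↦ (TotalSpace.mk' E4 (E4.ofTimeSpace (u y) y)
        ((Real.sqrt (1 - ‖∇ u y‖ ^ 2))⁻¹ • E4.ofTimeSpace 1 (∇ u (y : E3))) :
          TangentBundle 𝓘(ℝ, E4) E4)) := by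
  intro y
  rw [contMDiffAt_totalSpace]
  refine ⟨contMDiff_graph_slice hu y, ?_⟩
  simp only [trivializationAt_model_space_apply]
  exact contMDiff_normal_graph_slice hu hlt y

/-! ### Smooth embedding of the slice; the normal derivative paired with tangent vectors -/

/-- The preferred chart of the open submanifold `slice = ⊤ ⊆ ℝ³` at any point has source `univ`
(it is the restriction of the identity chart of `ℝ³`). [folklore] -/
private theorem chartAt_slice_source (x : slice) : (chartAt E3 x).source = univ := by
  rw [TopologicalSpace.Opens.chartAt_eq, OpenPartialHomeomorph.subtypeRestr_source,
    chartAt_self_eq, OpenPartialHomeomorph.refl_source, preimage_univ]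

/-- **The graph of a smooth function over the Minkowski slice is a smoothly embedded
hypersurface**: `y ↦ (u(y), y)` is a `C^∞` embedding `slice → ℝ⁴` (`isSmoothEmbedding_graph`
precomposed with the identity chart `slice ≅ ℝ³` of the open submanifold `slice = ⊤`,
`Manifold.IsSmoothEmbedding.comp_openPartialHomeomorph`) — an imbedding in the sense of
Hawking–Ellis 1973, §2.3, p. 23; the case `u = 0` is `isSmoothEmbedding_sliceEmbed_holds`.
[cite: HawkingEllis1973, §2.3 p. 23 and §2.7 p. 44] -/
theorem isSmoothEmbedding_graph_slice (hu : ContDiff ℝ ∞ u) :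
    Manifold.IsSmoothEmbedding 𝓘(ℝ, E3) 𝓘(ℝ, E4) ∞ fun y : slice ↦ E4.ofTimeSpace (u y) y := by
  set x₀ : slice := ⟨0, mem_slice 0⟩
  exact (isSmoothEmbedding_graph hu).comp_openPartialHomeomorph (chartAt E3 x₀)
    (chartAt_slice_source x₀) contMDiffOn_chart contMDiffOn_chart_symm

/-- `η((0, a), (s, w)) = ⟪a, w⟫` (O'Neill 1983, Ch. 3, p. 55: `ℝ⁴₁`).
[cite: ONeill1983, Ch. 3, p. 55] -/
private theorem bilin_ofTimeSpace_zero_left (a : E3) (s : ℝ) (w : E3) :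
    bilin (E4.ofTimeSpace 0 a) (E4.ofTimeSpace s w) = ⟪a, w⟫ := by
  rw [bilin_apply]
  simp only [E4.ofTimeSpace_apply_zero, E4.ofTimeSpace_apply_succ, PiLp.inner_apply,
    RCLike.inner_apply, conj_trivial, zero_mul, neg_zero, zero_add]
  exact Finset.sum_congr rfl fun i _ ↦ mul_comm _ _

/-- The differential of `y ↦ (1, ∇u(y))` is `v ↦ (0, d(∇u)_y v)`. [folklore] -/
private theorem hasFDerivAt_one_gradient (hu : ContDiff ℝ ∞ u) (y : E3) :
    HasFDerivAt (fun y ↦ E4.ofTimeSpace 1 (∇ u y))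
      ((LinearMap.toContinuousLinearMap (IsLinearMap.mk' _ isLinearMap_ofTimeSpace_zero)).comp
        (fderiv ℝ (∇ u) y)) y := by
  set L : E3 →L[ℝ] E4 :=
    LinearMap.toContinuousLinearMap (IsLinearMap.mk' _ isLinearMap_ofTimeSpace_zero) with hL
  have hcoe : (L : E3 → E4) = E4.ofTimeSpace 0 := rfl
  have hfun : (fun y ↦ E4.ofTimeSpace 1 (∇ u y)) =
      fun y ↦ (1 : ℝ) • E4.basisVector 0 + L (∇ u y) := by
    funext y
    rw [E4.ofTimeSpace_eq_smul_add 1 (∇ u y), hcoe]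
  rw [hfun]
  have hg : HasFDerivAt (∇ u) (fderiv ℝ (∇ u) y) y :=
    ((contDiff_gradient hu).differentiable (by simp) y).hasFDerivAt
  exact (L.hasFDerivAt.comp y hg).const_add _

/-- **The differential of the unit normal of a graph, paired with a tangent vector**: for
`N = c (1, ∇u)`, `c = (1 − ‖∇u‖²)^{-1/2}`, and `v, w ∈ ℝ³`,
`η(dN_y v, (⟪∇u(y), w⟫, w)) = c(y) ⟪d(∇u)_y v, w⟫` — the `dc` term drops out because
`(1, ∇u(y))` is `η`-orthogonal to the tangent vector `(⟪∇u(y), w⟫, w)`. This is the second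
fundamental form `K(v, w) = c ∂ᵢ∂ⱼu vⁱ wʲ` of the graph `t = u(x)` in Minkowski space-time
(Wald 1984, §10.2, (10.2.13) `K_ab = h_a{}^c ∇_c n_b` with `∇` flat).
[cite: Wald1984, §10.2 (10.2.13)] -/
theorem bilin_fderiv_normalMap_tangent (hu : ContDiff ℝ ∞ u) (hlt : ∀ y, ‖∇ u y‖ < 1)
    (y v w : E3) :
    bilin (fderiv ℝ (fun y ↦ (Real.sqrt (1 - ‖∇ u y‖ ^ 2))⁻¹ • E4.ofTimeSpace 1 (∇ u y)) y v)
        (E4.ofTimeSpace ⟪∇ u y, w⟫ w) =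
      (Real.sqrt (1 - ‖∇ u y‖ ^ 2))⁻¹ * ⟪fderiv ℝ (∇ u) y v, w⟫ := by
  have hc : DifferentiableAt ℝ (fun y ↦ (Real.sqrt (1 - ‖∇ u y‖ ^ 2))⁻¹) y :=
    (contDiff_normalFactor hu hlt).differentiable (by simp) y
  have hM := hasFDerivAt_one_gradient hu y
  have e1 : fderiv ℝ (fun y ↦ (Real.sqrt (1 - ‖∇ u y‖ ^ 2))⁻¹ • E4.ofTimeSpace 1 (∇ u y)) y v =
      (Real.sqrt (1 - ‖∇ u y‖ ^ 2))⁻¹ • E4.ofTimeSpace 0 (fderiv ℝ (∇ u) y v) +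
        (fderiv ℝ (fun y ↦ (Real.sqrt (1 - ‖∇ u y‖ ^ 2))⁻¹) y v) • E4.ofTimeSpace 1 (∇ u y) := by
    rw [fderiv_fun_smul hc hM.differentiableAt, hM.fderiv]
    rfl
  rw [e1, map_add, map_smul, map_smul, _root_.add_apply, _root_.smul_apply, _root_.smul_apply,
    bilin_ofTimeSpace_one_tangent, bilin_ofTimeSpace_zero_left, smul_zero, add_zero, smul_eq_mul]

/-! ### The induced vacuum data and the vacuum Cauchy development -/

/-- **Uniformly spacelike entire graphs carry vacuum data whose vacuum Cauchy development is
Minkowski space-time.** Let `u : ℝ³ → ℝ` be `C^∞` with `‖du‖ ≤ θ < 1`. On the Minkowski slice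
`slice = ℝ³` there is an initial data set `D = (h, k)` with
`h_y(v, w) = ⟪v, w⟫ − ⟪∇u(y), v⟫ ⟪∇u(y), w⟫` (the metric induced by `η` on the graph
`t = u(x)`, Wald 1984, (10.2.11)) and `k_y(v, w) = (1 − ‖∇u(y)‖²)^{-1/2} ⟪d(∇u)_y v, w⟫` (its
second fundamental form w.r.t. the future unit normal, Wald 1984, (10.2.13)), which solves the
vacuum constraint equations (Gauss–Codazzi in the Ricci-flat ambient space,
`exists_initialDataSet_induced_isVacuumConstraintSolution`; Choquet-Bruhat 2009, Ch. VI,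
Thm. 3.3), and which admits a **vacuum Cauchy development whose space-time is Minkowski
space-time** `(ℝ⁴, η, ∂ₜ)`: the embedding is the graph map `y ↦ (u(y), y)` (a smooth embedding,
`isSmoothEmbedding_graph_slice`, with future unit normal `(1 − ‖∇u‖²)^{-1/2} (1, ∇u)`,
`isFutureUnitNormal_graph_slice`), and its image is a Cauchy hypersurface because `u` is
`θ`-Lipschitz with `θ < 1` (`isCauchyHypersurface_range_graph_of_fderiv`). This is the family of
data sets and developments produced by the rigid positive energy theorem: Beig–Chruściel 1996,
Thm. 4.1 and the last paragraph of its proof ("`Σ` can be isometrically embedded in `ℝ⁴` … it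
is necessarily a graph over a spacelike plane `t = 0`"), whose conclusion
`∃ 𝒟 : CauchyDevelopment D, 𝒟.toSpacetime = Minkowski.spacetime` (the vendored
`positive_mass_rigidity_spacetime`) every member of the family satisfies; the member `u = 0` is
`Minkowski.vacuumCauchyDevelopment` (`MinkowskiCauchyDevelopment.lean`).
[cite: BeigChrusciel1996, Thm. 4.1 and its proof, §4 (last paragraph)] -/
theorem exists_vacuumCauchyDevelopment_graph (hu : ContDiff ℝ ∞ u) {θ : ℝ≥0} (hθ : θ < 1)
    (hb : ∀ y, ‖fderiv ℝ u y‖₊ ≤ θ) :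
    ∃ D : InitialDataSet 𝓘(ℝ, E3) slice,
      (∀ (y : slice) (v w : E3), D.h.inner y v w = ⟪v, w⟫ - ⟪∇ u y, v⟫ * ⟪∇ u y, w⟫) ∧
      (∀ (y : slice) (v w : E3),
        D.k y v w = (Real.sqrt (1 - ‖∇ u y‖ ^ 2))⁻¹ * ⟪fderiv ℝ (∇ u) y v, w⟫) ∧
      (∀ [D.metric.HasLeviCivita], D.IsVacuumConstraintSolution) ∧
      ∃ 𝒟 : VacuumCauchyDevelopment D, 𝒟.toSpacetime = spacetime := by
  haveI := smoothMetric.toPseudoRiemannianMetric.hasLeviCivita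
  have hd : Differentiable ℝ u := hu.differentiable (by simp)
  have hlt : ∀ y, ‖∇ u y‖ < 1 := fun y ↦ by
    rw [norm_gradient_eq_norm_fderiv]
    exact lt_of_le_of_lt (hb y) (by exact_mod_cast hθ)
  have hfi := isSpacelikeImmersion_graph_slice hu hlt
  have hfun := isFutureUnitNormal_graph_slice hd hlt
  have hlift := contMDiff_lift_graph_slice hu hlt
  have hm : Module.finrank ℝ E3 = 3 := finrank_euclideanSpace_fin
  have hm1 : Module.finrank ℝ E4 = 3 + 1 := finrank_euclideanSpace_fin
  obtain ⟨D, hDh, hDk, hvac⟩ :=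
    smoothMetric.toPseudoRiemannianMetric.exists_initialDataSet_induced_isVacuumConstraintSolution
      hfi hfun.1 hlift hm hm1 fun y ↦
        smoothMetric.toPseudoRiemannianMetric.ricci_eq_zero_of_val_eq_const bilin (fun _ ↦ rfl)
          (by decide) _
  refine ⟨D, fun y v w ↦ ?_, fun y v w ↦ ?_, hvac, ?_⟩
  · -- the induced metric `δ − du ⊗ du`
    rw [hDh y, PseudoRiemannianMetric.inducedBilin_apply, mfderiv_graph_slice hd y,
      mfderiv_graph_slice hd y]
    exact bilin_tangent_tangent (∇ u y) v w
  · -- the second fundamental form `c ⟪d(∇u) v, w⟫`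
    have hK : D.k y v w =
        smoothMetric.toPseudoRiemannianMetric.secondFundamentalForm 𝓘(ℝ, E3)
          (fun y : slice ↦ E4.ofTimeSpace (u y) y)
          (fun y : slice ↦ (Real.sqrt (1 - ‖∇ u y‖ ^ 2))⁻¹ • E4.ofTimeSpace 1 (∇ u (y : E3)))
          y v w := by
      rw [← hDk y]
      rfl
    have hf : MDifferentiableAt 𝓘(ℝ, E3) 𝓘(ℝ, E4) (fun y : slice ↦ E4.ofTimeSpace (u y) y) y :=
      (contMDiff_graph_slice hu y).mdifferentiableAt (by simp)
    have hN : DifferentiableAt ℝ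
        (fun y ↦ (Real.sqrt (1 - ‖∇ u y‖ ^ 2))⁻¹ • E4.ofTimeSpace 1 (∇ u y)) y :=
      (contDiff_normalMap hu hlt).differentiable (by simp) y
    have hν : MDifferentiableAt 𝓘(ℝ, E3) 𝓘(ℝ, E4)
        (fun y : slice ↦ (Real.sqrt (1 - ‖∇ u y‖ ^ 2))⁻¹ • E4.ofTimeSpace 1 (∇ u (y : E3))) y :=
      (contMDiff_normal_graph_slice hu hlt y).mdifferentiableAt (by simp)
    rw [hK, ModelSpace.secondFundamentalForm_eq_mfderiv (G₀ := bilin) (fun _ ↦ rfl)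
      BoundarylessManifold.isInteriorPoint hf hν v w, mfderiv_graph_slice hd y,
      OpensChart.mfderiv_eq y _ (fun y ↦ (Real.sqrt (1 - ‖∇ u y‖ ^ 2))⁻¹ •
        E4.ofTimeSpace 1 (∇ u y)) (fun _ ↦ rfl) hN]
    exact bilin_fderiv_normalMap_tangent hu hlt y v w
  · -- the vacuum Cauchy development
    have hrange : range (α := spacetime.carrier) (fun y : slice ↦ E4.ofTimeSpace (u y) y) =
        range (α := spacetime.carrier) fun y : E3 ↦ E4.ofTimeSpace (u y) y :=
      Set.ext fun x ↦ ⟨fun ⟨y, hy⟩ ↦ ⟨y, hy⟩, fun ⟨y, hy⟩ ↦ ⟨⟨y, mem_slice y⟩, hy⟩⟩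
    exact ⟨
      { toSpacetime := spacetime
        embed := fun y : slice ↦ E4.ofTimeSpace (u y) y
        isSmoothEmbedding := isSmoothEmbedding_graph_slice hu
        normal := fun y : slice ↦ (Real.sqrt (1 - ‖∇ u y‖ ^ 2))⁻¹ • E4.ofTimeSpace 1 (∇ u (y : E3))
        isFutureUnitNormal := hfun
        induced_h := fun y ↦ (hDh y).symm
        induced_k := fun y ↦ (hDk y).symm
        isCauchyHypersurface := by
          rw [hrange]
          exact isCauchyHypersurface_range_graph_of_fderiv hθ hd hb
        isRicciFlat := @isRicciFlat_holds }, rfl⟩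

/-- **Every uniformly spacelike entire graph inhabits the conclusion of the rigid positive energy
theorem**: for `u : ℝ³ → ℝ` of class `C^∞` with `‖du‖ ≤ θ < 1` there is an initial data set `D` on
`slice = ℝ³` — the vacuum data `(δ − du ⊗ du, (1 − ‖∇u‖²)^{-1/2} ∇∇u)` of
`exists_vacuumCauchyDevelopment_graph` — with a Cauchy development `𝒟` such that
`𝒟.toSpacetime = Minkowski.spacetime`, the literal conclusion of
`positive_mass_rigidity_spacetime` (Beig–Chruściel 1996, Thm. 4.1; the trivial member `u = 0` is
`positive_mass_rigidity_spacetime_conclusion_trivialData`). [cite: BeigChrusciel1996, Thm. 4.1] -/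
theorem exists_cauchyDevelopment_eq_spacetime_graph (hu : ContDiff ℝ ∞ u) {θ : ℝ≥0} (hθ : θ < 1)
    (hb : ∀ y, ‖fderiv ℝ u y‖₊ ≤ θ) :
    ∃ D : InitialDataSet 𝓘(ℝ, E3) slice,
      (∀ (y : slice) (v w : E3), D.h.inner y v w = ⟪v, w⟫ - ⟪∇ u y, v⟫ * ⟪∇ u y, w⟫) ∧
      ∃ 𝒟 : CauchyDevelopment D, 𝒟.toSpacetime = spacetime := by
  obtain ⟨D, hh, -, -, 𝒟, h𝒟⟩ := exists_vacuumCauchyDevelopment_graph hu hθ hb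
  exact ⟨D, hh, 𝒟.toCauchyDevelopment, h𝒟⟩

end Minkowski

end Literature.Geometry.Lorentzian

end
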